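import Literature.NumberTheory.Automorphic.SupercuspidalIdempotent
import Literature.NumberTheory.Automorphic.SupercuspidalPlaceNonvanishing
import Literature.NumberTheory.Automorphic.IntegratedOperatorLocalNonvanishing
import Literature.NumberTheory.Automorphic.MatrixCoefficientsSupercuspidalAdmissibleProofs
import Literature.NumberTheory.Automorphic.UnramifiedHeckeScalarsFlathProofs
import Literature.NumberTheory.Automorphic.CongruenceSubgroupExpansionGL
import HarnessLib

/-!
# The fixed factor at a supercuspidal place of a cuspidal representation: Gelbart's idempotent
# `e_v` with `(π ∘ ι_v)(e_v) ≠ 0` on the constituent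
(Gelbart, *Automorphic forms on adele groups* (1975), §10, pp. 151–153, (10.11): "the functions
`f_v = d(σ_v) conj ⟨σ_v(g) u_v, u_v⟩`, `v ∈ S`, … cut out the non-zero space
`{⊗_{v ∈ S} u_v} ⊗ V^S` of each `π^i` with `π^i_v ≅ σ_v`")

Topic `NumberTheory/Automorphic`; theorems only (no definition, no named fact, no instance
visible to importers). For a closed irreducible (e.g. cuspidal) constituent
`Π ≤ L²(GL_n(K) A_G \ GL_n(𝔸_K))` with an irreducible smooth supercuspidal local component `ρ_v`
at the finite place `v` (`HasLocalComponentAt Π v ρ_v`: a non-zero intertwiner `F : V_ρ → Π`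
along `ι_v`), the hypotheses of `exists_supercuspidalIdempotent` (`SupercuspidalIdempotent`) hold:

* the unitary structure is `F` itself — `⟪F(ρ g x), F(ρ g y)⟫ = ⟪Π(ι_v g) F x, Π(ι_v g) F y⟫ =
  ⟪F x, F y⟫` by the unitarity of the regular representation (`inner_map_map`), and `F` is
  injective (`ρ_v` irreducible);
* `ρ_v` is admissible (irreducible smooth supercuspidal, second countable group:
  `Representation.IsSupercuspidal.isAdmissible_holds`).

Hence `exists_supercuspidalIdempotent_localComponent`: **there is `e_v ∈ C_c(GL_n(K_v))`,
`e_v(g) = 1_{|det g| = 1} ⟪F(ρ_v(g) u), F u⟫` — a self-adjoint (`e^* = e`) idempotent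
(`e ⋆ e = c e`, `c > 0`) supercusp form (vanishing unipotent integrals) — with
`(Π ∘ ι_v)(e_v) ≠ 0`** (indeed `(Π ∘ ι_v)(e_v)(F u) ≠ 0`, by
`integratedOperator_restrict_apply_ne_zero` with `∫ e_v(g) ⟪F u, F(ρ_v(g) u)⟫ dg = c ‖F u‖² = c`).
This is the hypothesis `h0` of `exists_discreteAutomorphicRep_of_localFactors`
(`JacquetLanglandsSurjectiveRamifiedFactor`) at the place `v`, together with the local
idempotency feeding `mulConv_tensorPi_of_idempotent` (`PlacesTestFunctionAlgebra`): Gelbart's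
fixed ramified factor `ξ_S = ⊗_{v ∈ S} e_v` for a cuspidal `π` supercuspidal at the places of `S`.
Part of the inline (D-0026) decomposition of
`Literature.NumberTheory.Automorphic.jacquetLanglands_transfer_surjective` (Gelbart Thm. 10.5 (ii)).

## References

* S. Gelbart, *Automorphic forms on adele groups*, Ann. of Math. Studies 83 (1975), §10,
  pp. 151–153, (10.11) [Gelbart1975].
-/

noncomputable section

open MeasureTheory Measure Set Filter Topology IsDedekindDomain NumberField CompactlySupported
open scoped ComplexConjugate InnerProductSpace

namespace Literature.NumberTheory.Automorphic

namespace CutoffCoefficient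

section Invariance

variable {G : Type*} [Group G] {V : Type*} [AddCommGroup V] [Module ℂ V] {ρ : Representation ℂ G V}
  {H : Type*} [NormedAddCommGroup H] [InnerProductSpace ℂ H] {F : V →ₗ[ℂ] H} {G₀ : Subgroup G}

/-- **`e_u` is bi-invariant under `G₀ ∩ Stab(u)`**: for `k ∈ G₀` with `ρ(k) u = u`,
`e_u(k h) = e_u(h) = e_u(h k)` — on the left by unitarity (`eCoeff_inv_mul_of_mem`), on the right
because `ρ(h k) u = ρ(h) u` and `h k ∈ G₀ ↔ h ∈ G₀`. In particular `e_u` is locally constant when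
`G₀` and `Stab(u)` are open. [folklore] -/
theorem eCoeff_mul_eq_of_mem (hF : ∀ (g : G) (x y : V), ⟪F (ρ g x), F (ρ g y)⟫_ℂ = ⟪F x, F y⟫_ℂ)
    {u : V} {k : G} (hk : k ∈ G₀) (hku : ρ k u = u) (h : G) :
    eCoeff ρ F G₀ u (k * h) = eCoeff ρ F G₀ u h ∧ eCoeff ρ F G₀ u (h * k) = eCoeff ρ F G₀ u h := by
  constructor
  · -- left: `k = (k⁻¹)⁻¹` with `k⁻¹ ∈ G₀ ⊓ Stab(u)`
    have hu : u ∈ ρ.fixedPoints (G₀ ⊓ ρ.stabilizerSubgroup u) :=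
      (ρ.mem_fixedPoints_iff_le_stabilizerSubgroup _ u).2 inf_le_right
    have hk' : k⁻¹ ∈ G₀ ⊓ ρ.stabilizerSubgroup u :=
      Subgroup.inv_mem _ (Subgroup.mem_inf.2 ⟨hk, (ρ.mem_stabilizerSubgroup u k).2 hku⟩)
    have h1 := eCoeff_inv_mul_of_mem (G₀ := G₀) hF inf_le_left hu hk' h
    rwa [inv_inv] at h1
  · by_cases hh : h ∈ G₀
    · rw [eCoeff_of_mem (G₀.mul_mem hh hk), eCoeff_of_mem hh, map_mul, Module.End.mul_apply, hku]
    · have hhk : h * k ∉ G₀ := fun h' => hh (by simpa using G₀.mul_mem h' (G₀.inv_mem hk))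
      rw [eCoeff_of_not_mem hhk, eCoeff_of_not_mem hh]

end Invariance

end CutoffCoefficient

section LocalComponent

variable {n : ℕ} {K : Type} [Field K] [NumberField K] {v : HeightOneSpectrum (𝓞 K)}
  {μ : Measure (AdelicGroupData.gl n K).automorphicQuotient}
  [(AdelicGroupData.gl n K).IsAutomorphicMeasure μ]
  (W : ContRepresentation.ClosedSubrep ((AdelicGroupData.gl n K).rightRegular μ))
  {V : Type*} [AddCommGroup V] [Module ℂ V]
  {ρ : Representation ℂ (GL (Fin n) (v.adicCompletion K)) V}

/-- **A local component is a unitary structure**: for an intertwiner `F : V_ρ → Π` along `ι_v`,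
`⟪F(ρ g x), F(ρ g y)⟫ = ⟪F x, F y⟫` (unitarity of the regular representation on `Π`). [folklore] -/
theorem inner_localComponent_apply_apply {F : V →ₗ[ℂ] W.toSubmodule}
    (hF : ∀ (a : GL (Fin n) (v.adicCompletion K)) (x : V), F (ρ a x) = W.toContRep (GLn.toAdelic n K v a) (F x))
    (g : GL (Fin n) (v.adicCompletion K)) (x y : V) : ⟪F (ρ g x), F (ρ g y)⟫_ℂ = ⟪F x, F y⟫_ℂ := by
  rw [hF, hF]
  exact ContRepresentation.IsUnitary.inner_map_map
    (ClosedSubrep.isUnitary_toContRep ((AdelicGroupData.gl n K).isUnitary_rightRegular μ) W) _ _ _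

/-- **Gelbart's idempotent at a supercuspidal place of a constituent, with non-vanishing**
(Gelbart (1975), pp. 151–153, (10.11)). Let `Π ≤ L²(GL_n(K) A_G \ GL_n(𝔸_K))` be a closed
invariant subspace, `ρ` an irreducible smooth supercuspidal representation of `GL_n(K_v)` (`0 < n`)
which is a local component of `Π` at `v`, and `μ_v` a Haar measure on `GL_n(K_v)`. Then there are
an intertwiner `F : V_ρ → Π` along `ι_v`, a vector `u` with `‖F u‖ = 1`, `c > 0` and
`e ∈ C_c(GL_n(K_v))`, `e(g) = 1_{|det g| = 1} ⟪F(ρ(g) u), F u⟫`, with: `e^* = e`; `e ⋆ e = c e`;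
`∫_{𝔫_k} e(a (1 + Y) b) dY = 0` (`0 < k < n`); `∫ e(g) ũ(ρ(g) u) dμ_v = c ũ(u)` for all linear `ũ`;
**`(Π ∘ ι_v)(e) (F u) ≠ 0`**, in particular `(Π ∘ ι_v)(e) ≠ 0`; and `e` is bi-invariant under the
open subgroup `G⁰ ∩ Stab(u)` (so locally constant: a test function at `v`).
[cite: Gelbart1975, §10 pp. 151–153, (10.11)] -/
theorem exists_supercuspidalIdempotent_localComponent (hn : 0 < n)
    [MeasurableSpace (GL (Fin n) (v.adicCompletion K))] [BorelSpace (GL (Fin n) (v.adicCompletion K))]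
    [SecondCountableTopology (GL (Fin n) (v.adicCompletion K))]
    [ρ.IsIrreducible] (hρs : ρ.IsSmooth) (hρc : ρ.IsSupercuspidal) (hW : HasLocalComponentAt W v ρ)
    (μv : Measure (GL (Fin n) (v.adicCompletion K))) [μv.IsHaarMeasure]
    (hu : (W.toContRep.restrict (GLn.toAdelic n K v)).IsUnitary)
    (hc : (W.toContRep.restrict (GLn.toAdelic n K v)).IsStronglyContinuous) :
    ∃ (F : V →ₗ[ℂ] W.toSubmodule) (u : V) (c : ℝ) (e : C_c(GL (Fin n) (v.adicCompletion K), ℂ)),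
      (∀ (a : GL (Fin n) (v.adicCompletion K)) (x : V), F (ρ a x) = W.toContRep (GLn.toAdelic n K v a) (F x)) ∧
      Function.Injective F ∧ ‖F u‖ = 1 ∧ 0 < c ∧
      (∀ g, e g = CutoffCoefficient.eCoeff ρ F (GLn.detUnit n (v.adicCompletion K)) u g) ∧
      (∀ g, mulStar (⇑e) g = e g) ∧
      (∀ g, mulConv μv (⇑e) (⇑e) g = c * e g) ∧
      (∀ k, 0 < k → k < n → ∀ [MeasurableSpace (blockNilpotent n k (v.adicCompletion K))]
        [BorelSpace (blockNilpotent n k (v.adicCompletion K))]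
        (α : Measure (blockNilpotent n k (v.adicCompletion K))) [α.IsAddHaarMeasure]
        (a b : GL (Fin n) (v.adicCompletion K)),
        ∫ Y, e (a * unipotentOfBlock n k (v.adicCompletion K) (Multiplicative.ofAdd Y) * b) ∂α = 0) ∧
      (∀ ut : Module.Dual ℂ V, ∫ g, e g * ut (ρ g u) ∂μv = c * ut u) ∧
      (W.toContRep.restrict (GLn.toAdelic n K v)).integratedOperator hu hc μv e (F u) ≠ 0 ∧
      (∀ k ∈ GLn.detUnit n (v.adicCompletion K) ⊓ ρ.stabilizerSubgroup u, ∀ g,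
        e (k * g) = e g ∧ e (g * k) = e g) := by
  obtain ⟨F, hF0, hF⟩ := hW
  have hF' : ∀ (a : GL (Fin n) (v.adicCompletion K)) (x : V),
      F (ρ a x) = W.toContRep (GLn.toAdelic n K v a) (F x) := hF
  have hFi : Function.Injective F := injective_of_isIrreducible_of_intertwines_toAdelic W ‹ρ.IsIrreducible› hF0 hF'
  have hunit : ∀ (g : GL (Fin n) (v.adicCompletion K)) (x y : V), ⟪F (ρ g x), F (ρ g y)⟫_ℂ = ⟪F x, F y⟫_ℂ :=
    inner_localComponent_apply_apply W hF'
  haveI : NonarchimedeanGroup (GL (Fin n) (v.adicCompletion K)) := nonarchimedeanGroup_gl (v.adicCompletion K) n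
  have hρa : ρ.IsAdmissible := Representation.IsSupercuspidal.isAdmissible_holds hρs hρc
  -- a non-zero vector of `V`
  obtain ⟨v₀, hv₀⟩ : ∃ x : V, x ≠ 0 := by
    by_contra h
    push Not at h
    exact hF0 (LinearMap.ext fun x => by rw [h x, map_zero, LinearMap.zero_apply])
  obtain ⟨u, c, e, hu1, hcpos, he, hstar, hconv, hcusp, heig⟩ :=
    exists_supercuspidalIdempotent ρ F hn hρa hρc hunit hFi hv₀ μv
  refine ⟨F, u, c, e, hF', hFi, hu1, hcpos, he, hstar, hconv, hcusp, heig, ?_, fun k hk g => ?_⟩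
  swap
  · -- bi-invariance under `G⁰ ∩ Stab(u)`
    rw [he, he, he]
    exact CutoffCoefficient.eCoeff_mul_eq_of_mem hunit (Subgroup.mem_inf.1 hk).1
      ((ρ.mem_stabilizerSubgroup u k).1 (Subgroup.mem_inf.1 hk).2) g
  -- non-vanishing on `F u`: test against `ũ = ⟪F u, F ·⟫`, `∫ e ũ(ρ g u) = c ‖F u‖² = c ≠ 0`
  refine integratedOperator_restrict_apply_ne_zero (GLn.toAdelic n K v) hu hc μv F
    (fun g y => ?_) hFi (hρs u) e ((innerₛₗ ℂ (F u)).comp F) ?_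
  · rw [hF' g y]
  · have h1 : ((innerₛₗ ℂ (F u)).comp F) u = 1 := by
      rw [LinearMap.comp_apply, innerₛₗ_apply_apply, inner_self_eq_norm_sq_to_K, hu1]
      simp
    rw [heig, h1, mul_one]
    exact_mod_cast hcpos.ne'

/-- **The family of fixed ramified factors of a constituent supercuspidal at the places of `S`**
(Gelbart (1975), p. 153: `ξ_S = ⊗_{v ∈ S} f_v`). Let `Π ≤ L²` be closed invariant with, at every
`v ∈ S`, an irreducible smooth supercuspidal local component, and let `μ_v` be Haar measures.
Then there are `ξ_v ∈ C_c(GL_n(K_v))` and `c_v > 0` (`v ∈ S`) with `ξ_v^* = ξ_v`,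
`ξ_v ⋆ ξ_v = c_v ξ_v`, `ξ_v` a supercusp form, `(Π ∘ ι_v)(ξ_v) ≠ 0`, and `ξ_v` bi-invariant under an
open subgroup (locally constant) — the data consumed by `GLn.tensorCc` /
`exists_discreteAutomorphicRep_of_localFactors`, `mulConv_tensorPi_of_idempotent` and the test
function class `IsTestFunctionGL`. [cite: Gelbart1975, §10 pp. 151–153, (10.11)] -/
theorem exists_ramifiedFactor_family (hn : 0 < n)
    [∀ w : HeightOneSpectrum (𝓞 K), MeasurableSpace (GL (Fin n) (w.adicCompletion K))]
    [∀ w : HeightOneSpectrum (𝓞 K), BorelSpace (GL (Fin n) (w.adicCompletion K))]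
    [∀ w : HeightOneSpectrum (𝓞 K), SecondCountableTopology (GL (Fin n) (w.adicCompletion K))]
    (S : Finset (HeightOneSpectrum (𝓞 K)))
    (hS : ∀ w ∈ S, ∃ (Vw : Type) (_ : AddCommGroup Vw) (_ : Module ℂ Vw)
      (ρw : Representation ℂ (GL (Fin n) (w.adicCompletion K)) Vw),
      ρw.IsIrreducible ∧ ρw.IsSmooth ∧ ρw.IsSupercuspidal ∧ HasLocalComponentAt W w ρw)
    (μl : ∀ w : HeightOneSpectrum (𝓞 K), Measure (GL (Fin n) (w.adicCompletion K)))
    [∀ w, (μl w).IsHaarMeasure]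
    (hu : ∀ w, (W.toContRep.restrict (GLn.toAdelic n K w)).IsUnitary)
    (hc : ∀ w, (W.toContRep.restrict (GLn.toAdelic n K w)).IsStronglyContinuous) :
    ∃ (ξ : ∀ w : HeightOneSpectrum (𝓞 K), C_c(GL (Fin n) (w.adicCompletion K), ℂ))
      (c : HeightOneSpectrum (𝓞 K) → ℝ), ∀ w ∈ S,
      0 < c w ∧ (∀ g, mulStar (⇑(ξ w)) g = ξ w g) ∧
      (∀ g, mulConv (μl w) (⇑(ξ w)) (⇑(ξ w)) g = c w * ξ w g) ∧
      (∀ k, 0 < k → k < n → ∀ [MeasurableSpace (blockNilpotent n k (w.adicCompletion K))]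
        [BorelSpace (blockNilpotent n k (w.adicCompletion K))]
        (α : Measure (blockNilpotent n k (w.adicCompletion K))) [α.IsAddHaarMeasure]
        (a b : GL (Fin n) (w.adicCompletion K)),
        ∫ Y, ξ w (a * unipotentOfBlock n k (w.adicCompletion K) (Multiplicative.ofAdd Y) * b) ∂α = 0) ∧
      (W.toContRep.restrict (GLn.toAdelic n K w)).integratedOperator (hu w) (hc w) (μl w) (ξ w) ≠ 0 ∧
      ∃ U : Subgroup (GL (Fin n) (w.adicCompletion K)), IsOpen (U : Set (GL (Fin n) (w.adicCompletion K))) ∧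
        ∀ k ∈ U, ∀ g, ξ w (k * g) = ξ w g ∧ ξ w (g * k) = ξ w g := by
  -- the per-place, type-free existence statement
  have key : ∀ w ∈ S, ∃ (e : C_c(GL (Fin n) (w.adicCompletion K), ℂ)) (cw : ℝ),
      0 < cw ∧ (∀ g, mulStar (⇑e) g = e g) ∧ (∀ g, mulConv (μl w) (⇑e) (⇑e) g = cw * e g) ∧
      (∀ k, 0 < k → k < n → ∀ [MeasurableSpace (blockNilpotent n k (w.adicCompletion K))]
        [BorelSpace (blockNilpotent n k (w.adicCompletion K))]
        (α : Measure (blockNilpotent n k (w.adicCompletion K))) [α.IsAddHaarMeasure]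
        (a b : GL (Fin n) (w.adicCompletion K)),
        ∫ Y, e (a * unipotentOfBlock n k (w.adicCompletion K) (Multiplicative.ofAdd Y) * b) ∂α = 0) ∧
      (W.toContRep.restrict (GLn.toAdelic n K w)).integratedOperator (hu w) (hc w) (μl w) e ≠ 0 ∧
      ∃ U : Subgroup (GL (Fin n) (w.adicCompletion K)), IsOpen (U : Set (GL (Fin n) (w.adicCompletion K))) ∧
        ∀ k ∈ U, ∀ g, e (k * g) = e g ∧ e (g * k) = e g := by
    intro w hw
    obtain ⟨Vw, _, _, ρw, hirr, hsm, hsc, hW⟩ := hS w hw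
    haveI : ρw.IsIrreducible := hirr
    obtain ⟨F, u, cw, e, -, -, -, hcpos, -, hstar, hconv, hcusp, -, hne, hinv⟩ :=
      exists_supercuspidalIdempotent_localComponent W hn hsm hsc hW (μl w) (hu w) (hc w)
    refine ⟨e, cw, hcpos, hstar, hconv, hcusp, fun h0 => hne ?_,
      GLn.detUnit n (w.adicCompletion K) ⊓ ρw.stabilizerSubgroup u, GLn.isOpen_detUnit.inter (hsm u), hinv⟩
    rw [h0, FunLike.coe_zero, Pi.zero_apply]
  choose! e cw hspec using key
  exact ⟨e, cw, fun w hw => hspec w hw⟩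

end LocalComponent

end Literature.NumberTheory.Automorphic
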